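import Summits.ResolutionOfSingularities.ResolutionOfSingularities.Theorems.ValuativeLuAlphaPTorsorDimTwoTransport
import Literature.AlgebraicGeometry.Resolution.ArithmeticalThreefolds
import Mathlib.RingTheory.NoetherNormalization
import Mathlib.FieldTheory.IntermediateField.Adjoin.Basic

/-!
# `LuAlphaPTorsor`: reduction of the crux to closed-point centres

Crux `Valuative.LuAlphaPTorsor` (item `stmt-ResolutionOfSingularities-0641`), line
`pfaff-line-log-final-forms`, stub G `stub_closedPointReduction`: the crux for all data whose
centre `𝔪_O ∩ A₀` is a MAXIMAL ideal of the base `A₀` implies the crux in general.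

The argument is elementary (a ground-field extension inside `O`). Let `𝔭 = 𝔪_O ∩ A₀` and
Noether-normalise the affine `k`-domain `A₀/𝔭`: `k[X₁, …, X_s] ↪ A₀/𝔭`, injective and integral.
Lifts `y₁, …, y_s ∈ A₀` of the coordinates have `Q(y) ∉ 𝔭` for every non-zero polynomial `Q`,
so every element of the subfield `k' = k(y₁, …, y_s) ⊆ K` is a fraction of elements of `A₀` with
denominator a unit of `O`: `k' ⊆ (A₀)_𝔭 = locAtCentre A₀ O ⊆ O`. The finitely generated
`k'`-algebra `A₀' = k'[A₀]` satisfies `A₀ ⊆ A₀' ⊆ locAtCentre A₀ O`, hence has the same local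
ring at the centre (so it is regular there), and its centre `𝔭'` is maximal: `A₀'/𝔭'` is a
domain generated over the field `k'` by the image of `A₀/𝔭`, which is integral over
`k[y] ⊆ k'`, so `A₀'/𝔭'` is integral over `k'`, hence a field. The closed-point crux over `k'`
gives a finitely generated `k'`-algebra `A' = k'[G] ⊆ O` containing `A₀'[t]`, regular at the
centre with `Frac A' = K`; the finitely generated `k`-algebra `A = k[A₀, t, G]` has
`A ⊆ A' ⊆ locAtCentre A O`, so again the same local ring at the centre.
-/

set_option linter.dupNamespace false

namespace Summit.ResolutionOfSingularities.ResolutionOfSingularities.Theorems.PfaffLine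

open IsLocalRing Literature.AlgebraicGeometry.Resolution

section Helpers

variable {k K : Type} [Field k] [Field K] [Algebra k K]

/-- **Same local ring at the centre.** If `B ≤ B' ≤ B_{𝔪_O ∩ B}` inside `O`, then `B` is
regular at the centre of `O` iff `B'` is. [folklore] -/
theorem isRegularLocalRing_centre_iff_of_le_of_le {O : ValuationSubring K} {B B' : Subring K}
    (h : B ≤ O.toSubring) (h' : B' ≤ O.toSubring) (h₁ : B ≤ B')
    (h₂ : B' ≤ locAtCentre B O) :
    IsRegularLocalRing (Localization.AtPrime
        (Ideal.comap (Subring.inclusion h) (maximalIdeal O))) ↔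
      IsRegularLocalRing (Localization.AtPrime
        (Ideal.comap (Subring.inclusion h') (maximalIdeal O))) := by
  change IsRegularLocalRing (Localization.AtPrime (subringCentre B O h)) ↔
    IsRegularLocalRing (Localization.AtPrime (subringCentre B' O h'))
  rw [← isRegularLocalRing_locAtCentre_iff h, ← isRegularLocalRing_locAtCentre_iff h',
    locAtCentre_eq_of_le_of_le O h₁ h₂]

/-- **A purely transcendental subfield off the centre.** If `y : ι → K` takes values in a
subring `B` containing `k`, and every non-zero polynomial in `y` over `k` is a unit of `O`,
then the subfield `k(y) ⊆ K` lies in `B_{𝔪_O ∩ B}`. [folklore] -/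
theorem adjoin_range_subset_locAtCentre {ι : Type*} (O : ValuationSubring K) (B : Subring K)
    (y : ι → K) (hB : ∀ P : MvPolynomial ι k, MvPolynomial.aeval y P ∈ B)
    (hval : ∀ Q : MvPolynomial ι k, Q ≠ 0 → O.valuation (MvPolynomial.aeval y Q) = 1) :
    ((IntermediateField.adjoin k (Set.range y) : IntermediateField k K) : Set K) ⊆
      locAtCentre B O := by
  intro x hx
  obtain ⟨P, Q, rfl⟩ := (IntermediateField.mem_adjoin_range_iff k y x).mp hx
  by_cases hQ : Q = 0
  · rw [hQ, map_zero, div_zero]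
    exact (locAtCentre B O).zero_mem
  · exact ⟨_, hB P, _, hB Q, hval Q hQ, rfl⟩

/-- `Frac A = K` passes to any larger subalgebra, over any larger ground field. [folklore] -/
theorem isFractionRing_of_subset {k' : Type*} [Field k'] [Algebra k' K] {A : Subalgebra k K}
    {A' : Subalgebra k' K} (hle : (A : Set K) ⊆ A') (hA : IsFractionRing A K) :
    IsFractionRing A' K := by
  refine IsFractionRing.of_field A' K fun z => ?_
  obtain ⟨a, b, -, rfl⟩ := IsFractionRing.div_surjective (A := A) z
  exact ⟨⟨a, hle a.2⟩, ⟨b, hle b.2⟩, rfl⟩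

end Helpers

/-! ## Noether normalisation of the centre and the ground field `k(y)` -/

section Noether

variable {k K : Type} [Field k] [Field K] [Algebra k K]

/-- **The ground-field extension making the centre a closed point.** For a finitely generated
`A₀ ⊆ O`, there is a subfield `k ⊆ k' ⊆ K` contained in `(A₀)_{𝔪_O ∩ A₀}` such that the centre
of `O` on the finitely generated `k'`-algebra `k'[A₀]` is a maximal ideal: take
`k' = k(y₁, …, y_s)` for lifts `yᵢ ∈ A₀` of Noether-normalising coordinates of `A₀/(𝔪_O ∩ A₀)`.
[folklore] -/
theorem exists_intermediateField_centre_isMaximal (O : ValuationSubring K) (A₀ : Subalgebra k K)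
    (h₀ : A₀.toSubring ≤ O.toSubring) (hfg : A₀.FG) :
    ∃ k' : IntermediateField k K, ((k' : Set K) ⊆ locAtCentre A₀.toSubring O) ∧
      ∀ (h' : (Algebra.adjoin k' (A₀ : Set K)).toSubring ≤ O.toSubring),
        (Ideal.comap (Subring.inclusion h') (maximalIdeal O)).IsMaximal := by
  classical
  -- the centre `𝔭` of `O` on `A₀` and the affine `k`-domain `A₀/𝔭`
  set 𝔭 : Ideal A₀.toSubring := Ideal.comap (Subring.inclusion h₀) (maximalIdeal O)
  letI : Algebra k A₀.toSubring := inferInstanceAs (Algebra k A₀)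
  haveI : IsScalarTower k A₀.toSubring K := inferInstanceAs (IsScalarTower k A₀ K)
  haveI : Algebra.FiniteType k A₀.toSubring := A₀.fg_iff_finiteType.mp hfg
  -- Noether normalisation of `A₀/𝔭`
  obtain ⟨s, g, hginj, hgint⟩ := exists_integral_inj_algHom_of_fg k (A₀.toSubring ⧸ 𝔭)
  choose y hy using fun i : Fin s => Ideal.Quotient.mk_surjective (g (MvPolynomial.X i))
  have hgQ : ∀ Q : MvPolynomial (Fin s) k,
      Ideal.Quotient.mk 𝔭 (MvPolynomial.aeval y Q) = g Q := by
    intro Q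
    have h1 : Ideal.Quotient.mkₐ k 𝔭 (MvPolynomial.aeval y Q) =
        MvPolynomial.aeval (fun i => Ideal.Quotient.mkₐ k 𝔭 (y i)) Q :=
      MvPolynomial.comp_aeval_apply _ _ _
    simp only [Ideal.Quotient.mkₐ_eq_mk, hy] at h1
    rw [h1, ← MvPolynomial.comp_aeval, MvPolynomial.aeval_X_left, AlgHom.comp_id]
  -- KEY FACT: non-zero polynomials in `y` lie off the centre, hence are units of `O`
  have hkey : ∀ Q : MvPolynomial (Fin s) k, Q ≠ 0 → MvPolynomial.aeval y Q ∉ 𝔭 := by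
    intro Q hQ hmem
    apply hQ
    apply hginj
    rw [map_zero, ← hgQ, Ideal.Quotient.eq_zero_iff_mem]
    exact hmem
  set yK : Fin s → K := fun i => (y i : K)
  have haev : ∀ P : MvPolynomial (Fin s) k,
      MvPolynomial.aeval yK P = ((MvPolynomial.aeval y P : A₀.toSubring) : K) := fun P =>
    MvPolynomial.aeval_algebraMap_apply K y P
  have hval : ∀ Q : MvPolynomial (Fin s) k, Q ≠ 0 → O.valuation (MvPolynomial.aeval yK Q) = 1 := by
    intro Q hQ
    rw [haev]
    exact valuation_eq_one_of_not_mem_subringCentre h₀ (hkey Q hQ)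
  refine ⟨IntermediateField.adjoin k (Set.range yK), adjoin_range_subset_locAtCentre O A₀.toSubring
    yK (fun P => by rw [haev]; exact (MvPolynomial.aeval y P).2) hval, ?_⟩
  -- maximality of the centre of `k'[A₀]`
  intro h'
  set k' : IntermediateField k K := IntermediateField.adjoin k (Set.range yK)
  set A' : Subalgebra k' K := Algebra.adjoin k' (A₀ : Set K)
  letI : Algebra k' A'.toSubring := inferInstanceAs (Algebra k' A')
  haveI : IsScalarTower k' A'.toSubring K := inferInstanceAs (IsScalarTower k' A' K)
  set 𝔭' : Ideal A'.toSubring := Ideal.comap (Subring.inclusion h') (maximalIdeal O)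
  have hA₀A' : A₀.toSubring ≤ A'.toSubring := fun x hx => Algebra.subset_adjoin hx
  -- the maps `ι : A₀ → A'`, `ψ : A₀/𝔭 → A'/𝔭'`, `φ : k[X] → k'`
  set ι : A₀.toSubring →+* A'.toSubring := Subring.inclusion hA₀A'
  have hle : 𝔭 ≤ Ideal.comap ι 𝔭' := by
    intro x hx
    change ι x ∈ subringCentre A'.toSubring O h'
    rw [mem_subringCentre_iff]
    exact (mem_subringCentre_iff h₀ x).mp hx
  set ψ : A₀.toSubring ⧸ 𝔭 →+* A'.toSubring ⧸ 𝔭' := Ideal.quotientMap 𝔭' ι hle with hψ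
  have hyk' : ∀ i, yK i ∈ k' := fun i => IntermediateField.subset_adjoin k _ (Set.mem_range_self i)
  set y' : Fin s → k' := fun i => ⟨yK i, hyk' i⟩
  set φ : MvPolynomial (Fin s) k →+* k' := (MvPolynomial.aeval y').toRingHom
  have hcomp : ψ.comp (g : MvPolynomial (Fin s) k →+* A₀.toSubring ⧸ 𝔭) =
      (algebraMap k' (A'.toSubring ⧸ 𝔭')).comp φ := by
    refine MvPolynomial.ringHom_ext (fun c => ?_) (fun i => ?_)
    · change ψ (g (MvPolynomial.C c)) = algebraMap k' _ (MvPolynomial.aeval y' (MvPolynomial.C c))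
      rw [MvPolynomial.aeval_C, ← MvPolynomial.algebraMap_eq, AlgHom.commutes,
        ← Ideal.Quotient.mk_algebraMap, hψ, Ideal.quotientMap_mk, ← Ideal.Quotient.mk_algebraMap]
      exact congrArg _ (Subtype.ext (IsScalarTower.algebraMap_apply k k' K c))
    · change ψ (g (MvPolynomial.X i)) = algebraMap k' _ (MvPolynomial.aeval y' (MvPolynomial.X i))
      rw [MvPolynomial.aeval_X, ← hy i, hψ, Ideal.quotientMap_mk, ← Ideal.Quotient.mk_algebraMap]
      rfl
  -- `A'/𝔭'` is integral over the field `k'`, hence a field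
  refine Ideal.Quotient.maximal_of_isField _ ?_
  haveI : Algebra.IsIntegral k' (A'.toSubring ⧸ 𝔭') := by
    refine ⟨fun x => ?_⟩
    obtain ⟨⟨a, ha⟩, rfl⟩ := Ideal.Quotient.mk_surjective x
    refine Algebra.adjoin_induction (p := fun a ha =>
      IsIntegral k' (Ideal.Quotient.mk 𝔭' (⟨a, ha⟩ : A'.toSubring))) ?_ ?_ ?_ ?_ ha
    · -- generators `a ∈ A₀`: push the monic relation of `ā ∈ A₀/𝔭` over `k[X]` through `ψ`
      intro a haA₀
      obtain ⟨f, hfm, hf0⟩ := hgint (Ideal.Quotient.mk 𝔭 ⟨a, haA₀⟩)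
      rw [AlgHom.toRingHom_eq_coe] at hf0
      refine ⟨f.map φ, hfm.map φ, ?_⟩
      have hψa : ψ (Ideal.Quotient.mk 𝔭 ⟨a, haA₀⟩) =
          Ideal.Quotient.mk 𝔭' ⟨a, Algebra.subset_adjoin haA₀⟩ := by
        rw [hψ, Ideal.quotientMap_mk]
        rfl
      rw [Polynomial.eval₂_map, ← hcomp, ← hψa, ← Polynomial.hom_eval₂, hf0, map_zero]
    · intro r
      change IsIntegral k' (Ideal.Quotient.mk 𝔭' (algebraMap k' A'.toSubring r))
      rw [Ideal.Quotient.mk_algebraMap]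
      exact isIntegral_algebraMap
    · intro _ _ _ _ hx hy
      exact hx.add hy
    · intro _ _ _ _ hx hy
      exact hx.mul hy
  exact isField_of_isIntegral_of_isField' (Field.toIsField k')

end Noether

/-! ## The reduction -/

section Reduction

variable {k K : Type} [Field k] [Field K] [Algebra k K]

/-- `k[S] ⊆ k'[S']` as soon as `S ⊆ k'[S']`, for an intermediate field `k ⊆ k' ⊆ K`.
[folklore] -/
theorem adjoin_subset_adjoin (k' : IntermediateField k K) {S S' : Set K}
    (h : S ⊆ (Algebra.adjoin k' S' : Set K)) :
    (Algebra.adjoin k S : Set K) ⊆ (Algebra.adjoin k' S' : Set K) := by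
  have h' : Algebra.adjoin k S ≤ (Algebra.adjoin k' S').restrictScalars k := Algebra.adjoin_le h
  intro x hx
  exact (Subalgebra.mem_restrictScalars k).mp (h' hx)

/-- `k'[A₀]` is finitely generated over `k'` when `A₀` is finitely generated over `k ⊆ k'`.
[folklore] -/
theorem fg_adjoin_of_fg (k' : IntermediateField k K) {A₀ : Subalgebra k K} (hfg : A₀.FG) :
    (Algebra.adjoin k' (A₀ : Set K)).FG := by
  obtain ⟨T, hT⟩ := hfg
  refine ⟨T, le_antisymm (Algebra.adjoin_mono ?_) (Algebra.adjoin_le ?_)⟩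
  · rw [← hT]
    exact Algebra.subset_adjoin
  · rw [← hT]
    exact adjoin_subset_adjoin k' Algebra.subset_adjoin

end Reduction

/-- **Reduction of `LuAlphaPTorsor` to closed-point centres** (stub G of the line
`pfaff-line-log-final-forms`): the crux for all data whose centre `𝔪_O ∩ A₀` is a maximal
ideal of `A₀` implies the crux. Ground-field extension `k ⊆ k' = k(y) ⊆ (A₀)_{𝔪_O ∩ A₀}` by
lifts of Noether-normalising coordinates of `A₀/(𝔪_O ∩ A₀)`
(`exists_intermediateField_centre_isMaximal`), the closed-point crux over `k'`, and descent of
the resulting `k'`-model to a `k`-model with the same local ring at the centre. [folklore] -/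
theorem stub_closedPointReduction :
    ∀ p : ℕ, p.Prime → (∀ (k K : Type) [Field k] [CharP k p] [Field K] [Algebra k K] (O : ValuationSubring K) (A₀ : Subalgebra k K) (h₀ : A₀.toSubring ≤ O.toSubring) (t : K), A₀.FG → t ^ p ∈ A₀ → IsFractionRing (Algebra.adjoin k (insert t (A₀ : Set K))) K → IsRegularLocalRing (Localization.AtPrime (Ideal.comap (Subring.inclusion h₀) (IsLocalRing.maximalIdeal O))) → (Ideal.comap (Subring.inclusion h₀) (IsLocalRing.maximalIdeal O)).IsMaximal → ∃ (A : Subalgebra k K) (h : A.toSubring ≤ O.toSubring), A₀ ≤ A ∧ t ∈ A ∧ A.FG ∧ IsFractionRing A K ∧ IsRegularLocalRing (Localization.AtPrime (Ideal.comap (Subring.inclusion h) (IsLocalRing.maximalIdeal O)))) → ∀ (k K : Type) [Field k] [CharP k p] [Field K] [Algebra k K] (O : ValuationSubring K) (A₀ : Subalgebra k K) (h₀ : A₀.toSubring ≤ O.toSubring) (t : K), A₀.FG → t ^ p ∈ A₀ → IsFractionRing (Algebra.adjoin k (insert t (A₀ : Set K))) K → IsRegularLocalRing (Localization.AtPrime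 (Ideal.comap (Subring.inclusion h₀) (IsLocalRing.maximalIdeal O))) → ∃ (A : Subalgebra k K) (h : A.toSubring ≤ O.toSubring), A₀ ≤ A ∧ t ∈ A ∧ A.FG ∧ IsFractionRing A K ∧ IsRegularLocalRing (Localization.AtPrime (Ideal.comap (Subring.inclusion h) (IsLocalRing.maximalIdeal O))) := by
  intro p hp H k K _ _ _ _ O A₀ h₀ t hfg htp hfr hreg
  classical
  -- the ground field `k' = k(y) ⊆ (A₀)_{𝔪_O ∩ A₀}`
  obtain ⟨k', hk'loc, hmax⟩ := exists_intermediateField_centre_isMaximal O A₀ h₀ hfg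
  haveI : CharP k' p := charP_of_injective_algebraMap (algebraMap k k').injective p
  -- the base change `A₀' = k'[A₀]`, with the same local ring at the centre
  set A₀' : Subalgebra k' K := Algebra.adjoin k' (A₀ : Set K)
  have hA₀A₀' : A₀.toSubring ≤ A₀'.toSubring := fun x hx => Algebra.subset_adjoin hx
  let L₀ : Subalgebra k' K :=
    { locAtCentre A₀.toSubring O with algebraMap_mem' := fun c => hk'loc c.2 }
  have hA₀'loc : A₀'.toSubring ≤ locAtCentre A₀.toSubring O := by
    change A₀' ≤ L₀
    exact Algebra.adjoin_le (le_locAtCentre A₀.toSubring O)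
  have h₀' : A₀'.toSubring ≤ O.toSubring := hA₀'loc.trans (locAtCentre_le h₀)
  have hreg' : IsRegularLocalRing (Localization.AtPrime
      (Ideal.comap (Subring.inclusion h₀') (maximalIdeal O))) :=
    (isRegularLocalRing_centre_iff_of_le_of_le h₀ h₀' hA₀A₀' hA₀'loc).mp hreg
  have hfg' : A₀'.FG := fg_adjoin_of_fg k' hfg
  have htp' : t ^ p ∈ A₀' := Algebra.subset_adjoin htp
  have hfr' : IsFractionRing (Algebra.adjoin k' (insert t (A₀' : Set K))) K := by
    refine isFractionRing_of_subset (A := Algebra.adjoin k (insert t (A₀ : Set K)))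
      (adjoin_subset_adjoin k' ?_) hfr
    exact (Set.insert_subset_insert
      (show (A₀ : Set K) ⊆ (A₀' : Set K) from fun x hx => hA₀A₀' hx)).trans Algebra.subset_adjoin
  -- the closed-point crux over `k'`
  obtain ⟨A', h', hA₀'A', htA', hfgA', hfrA', hregA'⟩ :=
    H k' K O A₀' h₀' t hfg' htp' hfr' hreg' (hmax h₀')
  -- descent to `k`: `A = k[A₀, t, G]` for a finite generating set `G` of `A'` over `k'`
  obtain ⟨G, hG⟩ := hfgA'
  obtain ⟨T, hT⟩ := hfg
  have hTA₀ : ∀ x ∈ (T : Set K), x ∈ A₀ := fun x hx => by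
    rw [← hT]
    exact Algebra.subset_adjoin hx
  let A : Subalgebra k K := Algebra.adjoin k (insert t ((T : Set K) ∪ (G : Set K)))
  have hAfg : A.FG := ⟨insert t (T ∪ G), by rw [Finset.coe_insert, Finset.coe_union]⟩
  have htA : t ∈ A := Algebra.subset_adjoin (Set.mem_insert _ _)
  have hA₀A : A₀ ≤ A := by
    have hT' : (T : Set K) ⊆ A := fun x hx =>
      Algebra.subset_adjoin (Set.mem_insert_of_mem _ (Or.inl hx))
    rw [← hT]
    exact Algebra.adjoin_le hT'
  have hfrA : IsFractionRing A K :=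
    isFractionRing_of_le (Algebra.adjoin_le (Set.insert_subset htA hA₀A)) hfr
  -- `A ⊆ A'`
  let A'k : Subalgebra k K :=
    { A'.toSubring with
      algebraMap_mem' := fun c => by
        rw [IsScalarTower.algebraMap_apply k k' K]
        exact A'.algebraMap_mem _ }
  have hAA' : A.toSubring ≤ A'.toSubring := by
    change A ≤ A'k
    refine Algebra.adjoin_le ?_
    rintro x (rfl | hx | hx)
    · exact htA'
    · exact hA₀'A' (hA₀A₀' (hTA₀ x hx))
    · change x ∈ A'
      rw [← hG]
      exact Algebra.subset_adjoin hx
  have h : A.toSubring ≤ O.toSubring := hAA'.trans h'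
  -- `A' ⊆ A_{𝔪_O ∩ A}`: `A'` is generated over `k' ⊆ (A₀)_𝔭 ⊆ A_{𝔪_O ∩ A}` by `G ⊆ A`
  have hA₀A_sub : A₀.toSubring ≤ A.toSubring := fun x hx => hA₀A hx
  let L : Subalgebra k' K :=
    { locAtCentre A.toSubring O with
      algebraMap_mem' := fun c => locAtCentre_mono O hA₀A_sub (hk'loc c.2) }
  have hA'loc : A'.toSubring ≤ locAtCentre A.toSubring O := by
    change A' ≤ L
    rw [← hG]
    refine Algebra.adjoin_le fun x hx => ?_
    change x ∈ locAtCentre A.toSubring O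
    exact le_locAtCentre A.toSubring O
      (Algebra.subset_adjoin (Set.mem_insert_of_mem _ (Or.inr hx)))
  exact ⟨A, h, hA₀A, htA, hAfg, hfrA,
    (isRegularLocalRing_centre_iff_of_le_of_le h h' hAA' hA'loc).mpr hregA'⟩

end Summit.ResolutionOfSingularities.ResolutionOfSingularities.Theorems.PfaffLine
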